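import Literature.AnabelianGeometry.EtaleTheta.Discharge.Sec1DeltaThetaIsoTateOfClosure
import Literature.AnabelianGeometry.EtaleTheta.Discharge.Sec1DeltaYEllClosureOfExtension
import Literature.AnabelianGeometry.EtaleTheta.Discharge.Sec1DeltaYEllIsoTateOfClosure
import HarnessLib

/-!
# [EtTh] §1 p. 12: the typed cyclotomic package `Δ_Θ ≅ Ẑ(1)`, `1 → Ẑ(1) → Δ^ell_X → Ẑ → 1`,
# `(Δ^tp_Y)^ell ≅ Ẑ(1)` hangs on ONE typed fact — the FACT-LIST rows F-0657 · F-0658 · F-0659 · F-1697 of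
# `SemiGraphs/TemperedCyclotomic.lean` assembled (proof-only capstone)

Mochizuki, *The étale theta function and its Frobenioid-theoretic manifestations*, Publ. RIMS **45** (2009)
[EtTh], §1, PRIMS PDF p. 12 (printed 238): "Then we have a natural exact sequence `1 → Ẑ(1) → Δ^ell_X → Ẑ → 1`
… `1 → ∧² Δ^ell_X (≅ Ẑ(1)) → Δ^Θ_X → Δ^ell_X → 1` … `(Ẑ(1) ≅) Δ_Θ ⊆ Δ^Θ_X` … Thus, `(Δ^tp_Y)^ell ≅ Ẑ(1)`"
[cite: MochizukiEtTh2009, §1 p.12].  abc-iut cell, block C / F = FACT-PROVING WAVE, seat abc-iut-f-172 (gen 2),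
tranche 172; PROOF-ONLY (no `def`, no `instance`, no named fact); read-only consumer of abc-iut-L3's frozen
`TemperedCyclotomic.lean` (the four typed predicates on the origin binder `Ω : TemperedPiOrigin K`:
`DeltaEllExtension` F-0657, `DeltaThetaIsoTate` F-0658, `DeltaYEllIsoTate` F-0659, `DeltaYEllClosureIsoTate`
F-1697) and of the four landed reduction edges — abc-iut-L2-t7's `DeltaEllZHat.deltaEllExtension_of_deltaYEllClosureIsoTate`
(p432133) and `DeltaEllZHat.deltaYEllIsoTate_of_deltaYEllClosureIsoTate`, this seat's
`DeltaEllZHat.deltaYEllClosureIsoTate_of_deltaEllExtension` (p436437) and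
`OncePuncturedCyclotomic.deltaThetaIsoTate_of_deltaYEllClosureIsoTate` (p437928).

WHAT IS PROVED (for `K : Type`, universe `0` — the F-0658 edge inherits it from the generic Heisenberg test
groups; every named instance of the cell lives there):
* `OncePuncturedCyclotomic.cyclotomicPackage_of_deltaYEllClosureIsoTate` — F-1697 ⟹ F-0657 ∧ F-0658 ∧ F-0659;
* `OncePuncturedCyclotomic.cyclotomicPackage_of_deltaEllExtension` — F-0657 ⟹ F-0658 ∧ F-0659 ∧ F-1697;
* `OncePuncturedCyclotomic.deltaThetaIsoTate_of_deltaEllExtension` — F-0658 ⟸ F-0657 (composition).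
So a consumer holding EITHER `DeltaYEllClosureIsoTate Ω` OR `DeltaEllExtension Ω` holds all four typed p. 12
identifications; in FACT-LIST currency the rows F-0658, F-0659 and one of F-0657/F-1697 are CONDITIONAL on the
remaining one (their universal closures over the lawless binder are refuted as schemas, abc-iut-w6-d060
`TemperedCyclotomicClosures.lean`; nothing here asserts any of them outright).

HONEST FRAMING: [EtTh] is refereed; the L3 interface is DATA quoting print, asserted for no curve; implications
between OUR typed predicates only; nothing here bears on [IUTchIII] Cor. 3.12; typed ≠ proved; no side is taken
on any disputed claim.
-/

noncomputable section

namespace Literature.AnabelianGeometry.EtaleTheta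

open Literature.AnabelianGeometry.SemiGraphs

namespace OncePuncturedCyclotomic

variable {K : Type} [Field K]

/-- **The typed [EtTh] p. 12 cyclotomic package from F-1697 alone**: for every origin binder `Ω` over a field
`K : Type`, if the closure of the image of `Δ^tp_Y` in `Δ^ell_X` is a `Π^tp_X`-stable Tate twist
(`DeltaYEllClosureIsoTate Ω`, F-1697), then "`1 → Ẑ(1) → Δ^ell_X → Ẑ → 1`" (`DeltaEllExtension Ω`, F-0657),
"`Δ_Θ ≅ Ẑ(1)`" (`DeltaThetaIsoTate Ω`, F-0658) and "`(Δ^tp_Y)^ell ≅ Ẑ(1)`" (`DeltaYEllIsoTate Ω`, F-0659) all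
hold in their typed forms. [cite: MochizukiEtTh2009, §1 p.12] -/
theorem cyclotomicPackage_of_deltaYEllClosureIsoTate (Ω : TemperedPiOrigin K)
    (h : OncePuncturedTemperedGroup.DeltaYEllClosureIsoTate Ω) :
    OncePuncturedTemperedGroup.DeltaEllExtension Ω ∧ OncePuncturedTemperedGroup.DeltaThetaIsoTate Ω ∧
      OncePuncturedTemperedGroup.DeltaYEllIsoTate Ω :=
  ⟨DeltaEllZHat.deltaEllExtension_of_deltaYEllClosureIsoTate Ω h,
    deltaThetaIsoTate_of_deltaYEllClosureIsoTate Ω h,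
    DeltaEllZHat.deltaYEllIsoTate_of_deltaYEllClosureIsoTate Ω h⟩

/-- **F-0658 ⟸ F-0657**: for every origin binder `Ω` over a field `K : Type`, the typed
"`1 → Ẑ(1) → Δ^ell_X → Ẑ → 1`" (`DeltaEllExtension Ω`) implies the typed "`Δ_Θ ≅ Ẑ(1)`" (`DeltaThetaIsoTate Ω`)
— through F-1697 (`deltaYEllClosureIsoTate_of_deltaEllExtension`). [cite: MochizukiEtTh2009, §1 p.12] -/
theorem deltaThetaIsoTate_of_deltaEllExtension (Ω : TemperedPiOrigin K)
    (h : OncePuncturedTemperedGroup.DeltaEllExtension Ω) :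
    OncePuncturedTemperedGroup.DeltaThetaIsoTate Ω :=
  deltaThetaIsoTate_of_deltaYEllClosureIsoTate Ω (DeltaEllZHat.deltaYEllClosureIsoTate_of_deltaEllExtension Ω h)

/-- **The typed [EtTh] p. 12 cyclotomic package from F-0657 alone**: `DeltaEllExtension Ω` implies
`DeltaThetaIsoTate Ω` (F-0658), `DeltaYEllIsoTate Ω` (F-0659) and `DeltaYEllClosureIsoTate Ω` (F-1697), for every
origin binder `Ω` over a field `K : Type`. [cite: MochizukiEtTh2009, §1 p.12] -/
theorem cyclotomicPackage_of_deltaEllExtension (Ω : TemperedPiOrigin K)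
    (h : OncePuncturedTemperedGroup.DeltaEllExtension Ω) :
    OncePuncturedTemperedGroup.DeltaThetaIsoTate Ω ∧ OncePuncturedTemperedGroup.DeltaYEllIsoTate Ω ∧
      OncePuncturedTemperedGroup.DeltaYEllClosureIsoTate Ω :=
  have h' := DeltaEllZHat.deltaYEllClosureIsoTate_of_deltaEllExtension Ω h
  ⟨deltaThetaIsoTate_of_deltaYEllClosureIsoTate Ω h', DeltaEllZHat.deltaYEllIsoTate_of_deltaYEllClosureIsoTate Ω h', h'⟩

end OncePuncturedCyclotomic

end Literature.AnabelianGeometry.EtaleTheta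

end
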